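import Summits.RiemannHypothesis.RiemannHypothesis.Theses.WeilComb
import Mathlib.MeasureTheory.Integral.Layercake
import Mathlib.Analysis.Convex.Integral
import Mathlib.Analysis.Convex.Deriv
import Mathlib.MeasureTheory.Integral.IntervalIntegral.FundThmCalculus

/-!
# The bathtub principle for even increasing weights, by layer cake + Jensen
(helper for stub `stub_archBathtub` of line `Sketch`, crux `WeilComb.CombShapePositivity`,
item stmt-RiemannHypothesis-11229, route route-RiemannHypothesis-WeilComb; siege variation
"convexity / Jensen")

For a continuous weight `w : ℝ → ℝ` that is increasing in `|u|` and a measurable `G` with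
`0 ≤ G ≤ c`, `∫ G = m`:

  `c · ∫_{−m/(2c)}^{m/(2c)} w ≤ ∫ G w`                     (`mul_intervalIntegral_le_integral_mul`)

i.e. among all densities `0 ≤ G ≤ c` of mass `m` the centred plateau `c · 1_{[−m/2c, m/2c]}` minimises
`∫ G w` (Lieb–Loss, *Analysis*, Thm. 1.14, "bathtub principle"). The proof given here is the
convexity / Jensen one:

* `Ψ(x) = ∫_{−x}^{x} w` is convex on `[0, ∞)` since `Ψ'(x) = w(x) + w(−x)` is increasing
  (`hasDerivAt_symmIntegral`, `convexOn_symmIntegral`);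
* a set `E` of measure `2x` has `∫_E w ≥ Ψ(x)`: exchange `E \ [−x,x]` (where `w ≥ w(x)`) against
  `[−x,x] \ E` (where `w ≤ w(x)`), two sets of equal measure (`intervalIntegral_le_setIntegral`);
* layer cake (Cavalieri) for `G` against Lebesgue measure and against the weighted measure
  `(w − w(0)) · du`: `m = ∫_0^c |E_t| dt`, `∫ G (w − w 0) = ∫_0^c (∫_{E_t} (w − w 0)) dt`, `E_t = {t ≤ G}`
  (Mathlib's `Integrable.integral_eq_integral_Ioc_meas_le`);
* Jensen's inequality for the uniform probability on `(0, c]` and the convex `Ψ`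
  (Mathlib's `ConvexOn.map_set_average_le`): `⨍ Ψ(|E_t|/2) ≥ Ψ(⨍ |E_t|/2) = Ψ(m/(2c))`.

No number theory is used here; the stub itself is assembled in
`WeilCombCombShapePositivityStubArchBathtubJensen.lean`.
-/

noncomputable section

-- the sub-problem path RiemannHypothesis/RiemannHypothesis duplicates a namespace (D-0017)
set_option linter.dupNamespace false

open MeasureTheory Set Filter
open scoped ENNReal Topology

namespace Summit.RiemannHypothesis.RiemannHypothesis.Theorems.WeilCombArchBathtubJensen

variable {w : ℝ → ℝ}

/-- A weight that is increasing in `|u|` is minimised at `u = 0`. [folklore] -/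
theorem weight_zero_le (hmono : ∀ ⦃u v : ℝ⦄, |u| ≤ |v| → w u ≤ w v) (u : ℝ) : w 0 ≤ w u :=
  hmono (by simp [abs_nonneg])

/-! ### Sets of measure `2x` against the centred interval `[−x, x]` -/

/-- **Rearrangement for sets.** If `w` is continuous and increasing in `|u|`, `E` is a measurable set
of measure `2x` on which `w` is integrable, then `∫_{−x}^{x} w ≤ ∫_E w`: the parts `E \ [−x,x]` and
`[−x,x] \ E` have the same measure and `w ≥ w(x)` on the first, `w ≤ w(x)` on the second. [folklore] -/
theorem intervalIntegral_le_setIntegral (hw : Continuous w)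
    (hmono : ∀ ⦃u v : ℝ⦄, |u| ≤ |v| → w u ≤ w v) {E : Set ℝ} (hE : MeasurableSet E) {x : ℝ}
    (hx : 0 ≤ x) (hEx : volume E = ENNReal.ofReal (2 * x)) (hwE : IntegrableOn w E) :
    ∫ u in (-x)..x, w u ≤ ∫ u in E, w u := by
  set I : Set ℝ := Icc (-x) x with hI
  have hIm : MeasurableSet I := measurableSet_Icc
  have hIvol : volume I = ENNReal.ofReal (2 * x) := by
    rw [hI, Real.volume_Icc]
    congr 1
    ring
  have hwI : IntegrableOn w I := hw.continuousOn.integrableOn_compact isCompact_Icc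
  -- the interval integral is the set integral over `I`
  have hint : ∫ u in (-x)..x, w u = ∫ u in I, w u := by
    rw [intervalIntegral.integral_of_le (by linarith), hI, integral_Icc_eq_integral_Ioc]
  rw [hint]
  -- finiteness of all the pieces
  have hEfin : volume E ≠ ∞ := by rw [hEx]; exact ENNReal.ofReal_ne_top
  have hIfin : volume I ≠ ∞ := by rw [hIvol]; exact ENNReal.ofReal_ne_top
  have hEI : volume (E ∩ I) ≠ ∞ := measure_ne_top_of_subset inter_subset_left hEfin
  have hd1 : volume (E \ I) ≠ ∞ := measure_ne_top_of_subset Set.sdiff_subset hEfin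
  have hd2 : volume (I \ E) ≠ ∞ := measure_ne_top_of_subset Set.sdiff_subset hIfin
  -- the two differences have the same measure
  have hmeas : volume.real (E \ I) = volume.real (I \ E) := by
    have h1 := measure_inter_add_sdiff (μ := volume) E hIm
    have h2 := measure_inter_add_sdiff (μ := volume) I hE
    rw [inter_comm] at h2
    have e : volume (E ∩ I) + volume (E \ I) = volume (E ∩ I) + volume (I \ E) := by
      rw [h1, h2, hEx, hIvol]
    have : volume (E \ I) = volume (I \ E) := (ENNReal.add_right_inj hEI).1 e
    simp only [measureReal_def, this]
  -- off the interval `w ≥ w x`, on the interval `w ≤ w x`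
  have hge : ∀ u ∈ E \ I, w x ≤ w u := by
    intro u hu
    apply hmono
    rw [abs_of_nonneg hx]
    by_contra hlt
    have hlt' : |u| < x := lt_of_not_ge hlt
    exact hu.2 ⟨by linarith [neg_abs_le u], by linarith [le_abs_self u]⟩
  have hle : ∀ u ∈ I \ E, w u ≤ w x := by
    intro u hu
    apply hmono
    rw [abs_of_nonneg hx]
    exact abs_le.2 hu.1
  have hlow : w x * volume.real (E \ I) ≤ ∫ u in E \ I, w u := by
    have h := setIntegral_mono_on (integrableOn_const hd1) (hwE.mono_set Set.sdiff_subset)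
      (hE.diff hIm) hge
    rwa [setIntegral_const, smul_eq_mul, mul_comm] at h
  have hup : ∫ u in I \ E, w u ≤ w x * volume.real (I \ E) := by
    have h := setIntegral_mono_on (hwI.mono_set Set.sdiff_subset) (integrableOn_const hd2)
      (hIm.diff hE) hle
    rwa [setIntegral_const, smul_eq_mul, mul_comm] at h
  -- assemble
  have hE_split := integral_inter_add_sdiff hIm hwE
  have hI_split := integral_inter_add_sdiff hE hwI
  rw [inter_comm] at hI_split
  rw [hmeas] at hlow
  linarith

/-! ### Convexity of `x ↦ ∫_{−x}^{x} w` -/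

/-- `x ↦ ∫_{−x}^{x} w` has derivative `w(x) + w(−x)` (fundamental theorem of calculus). [folklore] -/
theorem hasDerivAt_symmIntegral (hw : Continuous w) (x : ℝ) :
    HasDerivAt (fun y : ℝ ↦ ∫ u in (-y)..y, w u) (w x + w (-x)) x := by
  have hF : ∀ y : ℝ, HasDerivAt (fun z : ℝ ↦ ∫ u in (0 : ℝ)..z, w u) (w y) y :=
    fun y ↦ (hw.integral_hasStrictDerivAt 0 y).hasDerivAt
  have heq : (fun y : ℝ ↦ ∫ u in (-y)..y, w u) =
      fun y ↦ (∫ u in (0 : ℝ)..y, w u) - ∫ u in (0 : ℝ)..(-y), w u := by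
    funext y
    have h1 : (∫ u in (-y)..0, w u) + ∫ u in (0 : ℝ)..y, w u = ∫ u in (-y)..y, w u :=
      intervalIntegral.integral_add_adjacent_intervals (hw.intervalIntegrable (-y) 0)
        (hw.intervalIntegrable 0 y)
    have h2 : ∫ u in (-y)..0, w u = -∫ u in (0 : ℝ)..(-y), w u :=
      intervalIntegral.integral_symm 0 (-y)
    linarith
  rw [heq]
  have h2 : HasDerivAt (fun y : ℝ ↦ ∫ u in (0 : ℝ)..(-y), w u) (w (-x) * (-1)) x :=
    (hF (-x)).comp x (hasDerivAt_neg x)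
  exact ((hF x).sub h2).congr_deriv (by ring)

/-- **Convexity.** For a continuous weight increasing in `|u|`, `x ↦ ∫_{−x}^{x} w` is convex on
`[0, ∞)` (its derivative `w(x) + w(−x)` is increasing there). [folklore] -/
theorem convexOn_symmIntegral (hw : Continuous w)
    (hmono : ∀ ⦃u v : ℝ⦄, |u| ≤ |v| → w u ≤ w v) :
    ConvexOn ℝ (Ici 0) (fun y : ℝ ↦ ∫ u in (-y)..y, w u) := by
  have hd := hasDerivAt_symmIntegral hw
  refine MonotoneOn.convexOn_of_deriv (convex_Ici 0)
    (fun y _ ↦ (hd y).continuousAt.continuousWithinAt)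
    (fun y _ ↦ (hd y).differentiableAt.differentiableWithinAt) ?_
  rw [interior_Ici]
  intro y hy z hz hyz
  rw [(hd y).deriv, (hd z).deriv]
  have hy0 : 0 < y := hy
  have hz0 : 0 < z := hz
  have h1 : w y ≤ w z := hmono (by rw [abs_of_pos hy0, abs_of_pos hz0]; exact hyz)
  have h2 : w (-y) ≤ w (-z) := hmono (by
    rw [abs_neg, abs_neg, abs_of_pos hy0, abs_of_pos hz0]; exact hyz)
  linarith

/-! ### The bathtub principle -/

/-- **Bathtub principle (Jensen form).** Let `w` be continuous and increasing in `|u|`, and let `G` be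
measurable with `0 ≤ G ≤ c` (`c > 0`), `G` and `G w` integrable, `m = ∫ G`. Then
`c ∫_{−m/(2c)}^{m/(2c)} w ≤ ∫ G w`.
Proof: with `v = w − w(0) ≥ 0`, `E_t = {t ≤ G}` and `Ψ(x) = ∫_{−x}^{x} v` (convex), layer cake gives
`∫ G v = ∫_0^c ∫_{E_t} v dt ≥ ∫_0^c Ψ(|E_t|/2) dt ≥ c Ψ((1/c)∫_0^c |E_t|/2 dt) = c Ψ(m/(2c))`
(rearrangement for sets, then Jensen), and the constant `w(0)` contributes `w(0) m` to both sides.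
(Lieb–Loss, *Analysis*, Thm. 1.14.) [folklore] -/
theorem mul_intervalIntegral_le_integral_mul (hw : Continuous w)
    (hmono : ∀ ⦃u v : ℝ⦄, |u| ≤ |v| → w u ≤ w v) {G : ℝ → ℝ} (hGm : Measurable G) {c : ℝ}
    (hc : 0 < c) (hG0 : ∀ u, 0 ≤ G u) (hGc : ∀ u, G u ≤ c) (hGi : Integrable G)
    (hGw : Integrable fun u ↦ G u * w u) :
    c * ∫ u in (-((∫ u, G u) / (2 * c)))..((∫ u, G u) / (2 * c)), w u ≤ ∫ u, G u * w u := by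
  -- the shifted weight `v = w − w 0 ≥ 0`
  set v : ℝ → ℝ := fun u ↦ w u - w 0 with hv
  have hv0 : ∀ u, 0 ≤ v u := fun u ↦ sub_nonneg.2 (weight_zero_le hmono u)
  have hvc : Continuous v := hw.sub continuous_const
  have hvmono : ∀ ⦃u u' : ℝ⦄, |u| ≤ |u'| → v u ≤ v u' := fun u u' h ↦ sub_le_sub_right (hmono h) _
  set m : ℝ := ∫ u, G u with hm
  set T : ℝ := m / (2 * c) with hT
  have hm0 : 0 ≤ m := integral_nonneg hG0
  have hT0 : 0 ≤ T := by positivity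
  have hcT : c * (2 * T) = m := by rw [hT]; field_simp
  have hGv : Integrable fun u ↦ G u * v u := by
    have : (fun u ↦ G u * v u) = fun u ↦ G u * w u - w 0 * G u := by
      funext u; simp only [hv]; ring
    rw [this]
    exact hGw.sub (hGi.const_mul _)
  -- reduction to the shifted weight
  suffices key : c * ∫ u in (-T)..T, v u ≤ ∫ u, G u * v u by
    have e1 : ∫ u in (-T)..T, w u = (∫ u in (-T)..T, v u) + 2 * T * w 0 := by
      have : w = fun u ↦ v u + w 0 := by funext u; simp [hv]
      conv_lhs => rw [this]
      rw [intervalIntegral.integral_add (hvc.intervalIntegrable _ _) intervalIntegrable_const,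
        intervalIntegral.integral_const, smul_eq_mul]
      ring
    have e2 : ∫ u, G u * w u = (∫ u, G u * v u) + w 0 * m := by
      have : (fun u ↦ G u * w u) = fun u ↦ G u * v u + w 0 * G u := by
        funext u; simp only [hv]; ring
      rw [this, integral_add hGv (hGi.const_mul _), integral_const_mul]
    rw [e1, e2, mul_add]
    have : c * (2 * T * w 0) = w 0 * m := by rw [← hcT]; ring
    linarith
  -- the weighted measure `ν = v · du`
  set d : ℝ → ℝ≥0∞ := fun u ↦ ENNReal.ofReal (v u) with hd
  have hdm : Measurable d := ENNReal.measurable_ofReal.comp hvc.measurable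
  have hdfin : ∀ᵐ u ∂(volume : Measure ℝ), d u < ∞ := ae_of_all _ fun u ↦ ENNReal.ofReal_lt_top
  have hdreal : ∀ u, (d u).toReal = v u := fun u ↦ ENNReal.toReal_ofReal (hv0 u)
  set ν : Measure ℝ := volume.withDensity d with hν
  have hGν : Integrable G ν := by
    rw [hν, integrable_withDensity_iff_integrable_smul' hdm hdfin]
    have : (fun u ↦ (d u).toReal • G u) = fun u ↦ G u * v u := by
      funext u; rw [hdreal, smul_eq_mul, mul_comm]
    rw [this]
    exact hGv
  have hGν_int : ∫ u, G u ∂ν = ∫ u, G u * v u := by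
    rw [hν, integral_withDensity_eq_integral_toReal_smul hdm hdfin]
    congr 1
    funext u
    rw [hdreal, smul_eq_mul, mul_comm]
  -- level sets `E_t = {t ≤ G}`
  have hEsm : ∀ t : ℝ, MeasurableSet {a : ℝ | t ≤ G a} := fun t ↦
    measurableSet_le measurable_const hGm
  have hEsfin : ∀ t : ℝ, 0 < t → volume {a : ℝ | t ≤ G a} < ∞ := fun t ht ↦
    hGi.measure_ge_lt_top ht
  have hEsνfin : ∀ t : ℝ, 0 < t → ν {a : ℝ | t ≤ G a} < ∞ := fun t ht ↦
    hGν.measure_ge_lt_top ht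
  -- layer cake, twice
  have hLC1 : m = ∫ t in Ioc 0 c, volume.real {a : ℝ | t ≤ G a} :=
    hGi.integral_eq_integral_Ioc_meas_le (ae_of_all _ hG0) (ae_of_all _ hGc)
  have hLC2 : ∫ u, G u ∂ν = ∫ t in Ioc 0 c, ν.real {a : ℝ | t ≤ G a} :=
    hGν.integral_eq_integral_Ioc_meas_le (ae_of_all _ hG0) (ae_of_all _ hGc)
  -- the convex function `Ψ`
  set Ψ : ℝ → ℝ := fun y ↦ ∫ u in (-y)..y, v u with hΨ
  have hΨconv : ConvexOn ℝ (Ici 0) Ψ := convexOn_symmIntegral hvc hvmono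
  have hΨcont : Continuous Ψ :=
    continuous_iff_continuousAt.2 fun y ↦ (hasDerivAt_symmIntegral hvc y).continuousAt
  have hΨnn : ∀ y : ℝ, 0 ≤ y → 0 ≤ Ψ y := fun y hy ↦
    intervalIntegral.integral_nonneg (by linarith) fun u _ ↦ hv0 u
  -- the half-measures of the level sets and the per-level rearrangement
  set f : ℝ → ℝ := fun t ↦ volume.real {a : ℝ | t ≤ G a} / 2 with hf
  have hkey : ∀ t : ℝ, 0 < t → Ψ (f t) ≤ ν.real {a : ℝ | t ≤ G a} := by
    intro t ht
    have hfin := hEsfin t ht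
    have hνE : ν {a : ℝ | t ≤ G a} = ∫⁻ u in {a : ℝ | t ≤ G a}, d u := by
      rw [hν, withDensity_apply _ (hEsm t)]
    have hvE : IntegrableOn v {a : ℝ | t ≤ G a} := by
      refine ⟨hvc.aestronglyMeasurable.restrict, ?_⟩
      rw [hasFiniteIntegral_iff_ofReal (ae_of_all _ hv0)]
      calc ∫⁻ u in {a : ℝ | t ≤ G a}, ENNReal.ofReal (v u) = ν {a : ℝ | t ≤ G a} := hνE.symm
        _ < ∞ := hEsνfin t ht
    have hνreal : ν.real {a : ℝ | t ≤ G a} = ∫ u in {a : ℝ | t ≤ G a}, v u := by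
      rw [measureReal_def, hνE, integral_eq_lintegral_of_nonneg_ae (ae_of_all _ hv0)
        hvc.aestronglyMeasurable.restrict]
    rw [hνreal]
    refine intervalIntegral_le_setIntegral hvc hvmono (hEsm t) (by positivity) ?_ hvE
    show volume {a : ℝ | t ≤ G a} = ENNReal.ofReal (2 * (volume.real {a : ℝ | t ≤ G a} / 2))
    rw [measureReal_def, show 2 * ((volume {a : ℝ | t ≤ G a}).toReal / 2) =
      (volume {a : ℝ | t ≤ G a}).toReal by ring, ENNReal.ofReal_toReal hfin.ne]
  -- integrability of `t ↦ |E_t|` and `t ↦ ν(E_t)` on `(0, c]` (layer cake in `ℝ≥0∞`)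
  have hmeasI : ∀ μ : Measure ℝ, Integrable G μ →
      IntegrableOn (fun t ↦ μ.real {a : ℝ | t ≤ G a}) (Ioc 0 c) := by
    intro μ hGμ
    have hanti : Antitone fun t : ℝ ↦ μ {a : ℝ | t ≤ G a} :=
      fun s t hst ↦ measure_mono fun a (ha : t ≤ G a) ↦ hst.trans ha
    have hmeas : Measurable fun t : ℝ ↦ μ.real {a : ℝ | t ≤ G a} :=
      hanti.measurable.ennreal_toReal
    refine ⟨hmeas.aestronglyMeasurable, ?_⟩
    have hlc := lintegral_eq_lintegral_meas_le μ (ae_of_all _ hG0) hGμ.aemeasurable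
    have hfin : ∫⁻ t in Ioi 0, μ {a : ℝ | t ≤ G a} < ∞ := by
      rw [← hlc]
      exact hGμ.lintegral_lt_top
    refine lt_of_le_of_lt ?_ hfin
    calc ∫⁻ t in Ioc 0 c, ‖μ.real {a : ℝ | t ≤ G a}‖ₑ
        ≤ ∫⁻ t in Ioc 0 c, μ {a : ℝ | t ≤ G a} := by
          refine lintegral_mono fun t ↦ ?_
          rw [measureReal_def, Real.enorm_eq_ofReal ENNReal.toReal_nonneg]
          exact ENNReal.ofReal_toReal_le
      _ ≤ ∫⁻ t in Ioi 0, μ {a : ℝ | t ≤ G a} := lintegral_mono_set Ioc_subset_Ioi_self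
  have hI1 : IntegrableOn (fun t ↦ volume.real {a : ℝ | t ≤ G a}) (Ioc 0 c) := hmeasI volume hGi
  have hI2 : IntegrableOn (fun t ↦ ν.real {a : ℝ | t ≤ G a}) (Ioc 0 c) := hmeasI ν hGν
  have hfI : IntegrableOn f (Ioc 0 c) := hI1.div_const 2
  have hΨfI : IntegrableOn (Ψ ∘ f) (Ioc 0 c) := by
    refine Integrable.mono' hI2 (hΨcont.comp_aestronglyMeasurable hfI.aestronglyMeasurable) ?_
    refine (ae_restrict_iff' measurableSet_Ioc).2 (ae_of_all _ fun t ht ↦ ?_)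
    rw [Function.comp_apply, Real.norm_eq_abs, abs_of_nonneg (hΨnn _ (by positivity))]
    exact hkey t ht.1
  -- Jensen for the uniform probability on `(0, c]`
  have hvol : volume (Ioc (0 : ℝ) c) = ENNReal.ofReal c := by rw [Real.volume_Ioc, sub_zero]
  have h0 : volume (Ioc (0 : ℝ) c) ≠ 0 := by rw [hvol]; exact (ENNReal.ofReal_pos.2 hc).ne'
  have htop : volume (Ioc (0 : ℝ) c) ≠ ∞ := by rw [hvol]; exact ENNReal.ofReal_ne_top
  have hmem : ∀ᵐ t ∂(volume : Measure ℝ).restrict (Ioc 0 c), f t ∈ Ici (0 : ℝ) :=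
    ae_of_all _ fun t ↦ mem_Ici.2 (by positivity)
  have hJ := hΨconv.map_set_average_le hΨcont.continuousOn isClosed_Ici h0 htop hmem hfI hΨfI
  have hvolreal : volume.real (Ioc (0 : ℝ) c) = c := by
    rw [measureReal_def, hvol, ENNReal.toReal_ofReal hc.le]
  have havf : ⨍ t in Ioc 0 c, f t = T := by
    rw [setAverage_eq, hvolreal, smul_eq_mul, hf, integral_div, ← hLC1, hT]
    field_simp
  have havΨ : ⨍ t in Ioc 0 c, Ψ (f t) ≤ c⁻¹ * ∫ u, G u * v u := by
    rw [setAverage_eq, hvolreal, smul_eq_mul]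
    refine mul_le_mul_of_nonneg_left ?_ (inv_nonneg.2 hc.le)
    rw [← hGν_int, hLC2]
    exact setIntegral_mono_on hΨfI hI2 measurableSet_Ioc fun t ht ↦ hkey t ht.1
  rw [havf] at hJ
  have hfinal := hJ.trans havΨ
  calc c * ∫ u in (-T)..T, v u = c * Ψ T := rfl
    _ ≤ c * (c⁻¹ * ∫ u, G u * v u) := mul_le_mul_of_nonneg_left hfinal hc.le
    _ = ∫ u, G u * v u := by field_simp

/-- **Bathtub principle, registered form** (sub-goal `bathtub_jensen` of item stmt-RiemannHypothesis-11229,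
serving stub `stub_archBathtub`): for a continuous weight `w` increasing in `|u|` and a measurable
`0 ≤ G ≤ c` (`c > 0`) with `G`, `G w` integrable, `c ∫_{−m/(2c)}^{m/(2c)} w ≤ ∫ G w`, `m = ∫ G`
(`mul_intervalIntegral_le_integral_mul`, layer cake + Jensen). [folklore] -/
theorem bathtub_jensen : ∀ (w : ℝ → ℝ), Continuous w → (∀ u v : ℝ, |u| ≤ |v| → w u ≤ w v) →
    ∀ (G : ℝ → ℝ) (c : ℝ), Measurable G → 0 < c → (∀ u : ℝ, 0 ≤ G u) → (∀ u : ℝ, G u ≤ c) →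
    MeasureTheory.Integrable G → MeasureTheory.Integrable (fun u : ℝ => G u * w u) →
    c * ∫ u in (-((∫ u, G u) / (2 * c)))..((∫ u, G u) / (2 * c)), w u ≤ ∫ u, G u * w u := by
  intro w hw hmono G c hGm hc hG0 hGc hGi hGw
  exact mul_intervalIntegral_le_integral_mul hw (fun u v h ↦ hmono u v h) hGm hc hG0 hGc hGi hGw

end Summit.RiemannHypothesis.RiemannHypothesis.Theorems.WeilCombArchBathtubJensen

end
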